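import Summits.ResolutionOfSingularities.ResolutionOfSingularities.Theorems.FrobeniusClosingPatchingRelPerfectConeMemberLevelThree
import Summits.ResolutionOfSingularities.ResolutionOfSingularities.Theorems.FrobeniusClosingPatchingRelPerfectConeMemberLevelOne
import Summits.ResolutionOfSingularities.ResolutionOfSingularities.Theorems.FrobeniusClosingPatchingRelPerfectJacobianCriterion
import HarnessLib

/-!
# Crux `PatchingRelPerfect` (stmt-ResolutionOfSingularities-16161), chain w52 — CORE RUNG r2pt,
# part 2b: the vertex blow-up `Bl_{z₀}`, abstractly — the cone ideal `𝔨 = (t, F)` and the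
# companion factor `𝔴 = (v)² + (t)` on the charts of `Bl_{(t, v₀, v₁, v₂)}` (identities)

[OURS · L1 W5.2 · rung] Level two of the cone tower, over an abstract commutative ring `A` (part
3 takes `A = B₃`, the vertex chart of `Bl_𝔪 Spec S`, `t = u = x₃/1`, `v_k = e_k = x_k/x₃`): the
centre is `c = (t, v₀, v₁, v₂)` (the vertex `z₀`), the cone is `𝔨 = (t, F)`, `F = v₀v₁ + v₂²`,
and `𝔴 = (v₀, v₁, v₂)² + (t)`.  On the Rees chart `C_j = (A[(c)τ])_{(c_j τ)}` (exceptional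
parameter `w`, generators `e'_l`, `u' = e'₀`, `G = e'₁e'₂ + e'₃²`) we PROVE, over any ring:

* `chartBase_F_two` (`ψ F = w² G`), `map_chartBase_kk` (`𝔨 C_j = w (u', w G)`),
  `map_chartBase_ww` (`𝔴 C_j = w (w (e')² + (u'))`), `map_chartBase_kw_zero` (on the `t`-chart
  `(𝔨 𝔴) C₀ = (w²)`), `map_chartBase_kw_succ` (on the `v_k`-chart
  `(𝔨 𝔴) C_j = w² · (u', w G) · (w, u')` — the last factor is the plane `W₀ = E_{z₀} ∩ E^{st}`);

plus `exists_quotient_equiv_sup_span` (a quotient isomorphism with one extra relation) and index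
bookkeeping.  The regularity half (discharging the hypotheses of the last step on the
`v_k`-charts and the level-two theorem `isRegular_of_isBlowup_kw_mul_span`) is
`…ConeMemberLevelTwo.lean`.  Nothing here is a statement of the manuscript under review.

## References

* The Stacks Project, Tags 080A, 080B, 0804, 07Z3, 0BIQ. [StacksProject]
* Q. Liu, *Algebraic Geometry and Arithmetic Curves*, OUP 2002, Thm. 8.1.19 (a). [Liu2002]
* H. Matsumura, *Commutative Ring Theory*, CUP 1986, Thm. 14.2. [Matsumura1987]
-/

-- `Summit.<Summit>.<Sub>.Theorems` with `Sub = Summit` (single-conjunct summit, D-0017)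
set_option linter.dupNamespace false

noncomputable section

open CategoryTheory CategoryTheory.Limits AlgebraicGeometry Literature.AlgebraicGeometry.Resolution
open IsLocalRing

namespace Summit.ResolutionOfSingularities.ResolutionOfSingularities.Theorems

namespace ConeRung

universe u

/-! ## A quotient isomorphism with one extra relation -/

/-- Given `ε : P ≅ C ⧸ I` and `F₀ ∈ P` lifting `G ∈ C`, the induced `P ⧸ (F₀) ≅ C ⧸ (I + (G))`
together with its value on classes. [folklore] -/
theorem exists_quotient_equiv_sup_span {P C : Type*} [CommRing P] [CommRing C] (I : Ideal C)
    (ε : P ≃+* C ⧸ I) (F₀ : P) (G : C) (hF₀ : ε F₀ = Ideal.Quotient.mk I G) :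
    ∃ eq : (P ⧸ Ideal.span {F₀}) ≃+* (C ⧸ (I ⊔ Ideal.span {G})),
      ∀ (p : P) (b : C), ε p = Ideal.Quotient.mk I b →
        eq (Ideal.Quotient.mk _ p) = Ideal.Quotient.mk _ b := by
  have h1 : (Ideal.span {G}).map (Ideal.Quotient.mk I) =
      (Ideal.span {F₀}).map (ε : P →+* C ⧸ I) := by
    rw [Ideal.map_span, Set.image_singleton, Ideal.map_span, Set.image_singleton, RingHom.coe_coe,
      hF₀]
  let e1 : (P ⧸ Ideal.span {F₀}) ≃+* (C ⧸ I) ⧸ (Ideal.span {G}).map (Ideal.Quotient.mk I) :=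
    Ideal.quotientEquiv _ _ ε h1
  let e2 := DoubleQuot.quotQuotEquivQuotSup I (Ideal.span {G})
  refine ⟨e1.trans e2, fun p b hpb => ?_⟩
  rw [RingEquiv.trans_apply]
  have he1 : e1 (Ideal.Quotient.mk _ p) = DoubleQuot.quotQuotMk I (Ideal.span {G}) b := by
    rw [Ideal.quotientEquiv_mk]
    exact congrArg (Ideal.Quotient.mk ((Ideal.span {G}).map (Ideal.Quotient.mk I))) hpb
  rw [he1, DoubleQuot.quotQuotEquivQuotSup_quotQuotMk]

/-! ## Level two over any ring -/

section AnyRing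

variable {A : Type u} [CommRing A] (t : A) (v : Fin 3 → A) (j : Fin 4)

local notation3 "cc" => (Fin.cons t v : Fin 4 → A)
local notation3 "F" => v 0 * v 1 + v 2 ^ 2
local notation3 "C" => chartRing cc j
local notation3 "ψ" => chartBase cc j
local notation3 "w" => chartBase cc j (cc j)
local notation3 "e'[" l "]" => chartGen cc j l
local notation3 "G" => chartGen cc j 1 * chartGen cc j 2 + chartGen cc j 3 ^ 2

/-- **`ψ(F) = w² G`**, `G = e'₁e'₂ + e'₃²`, on every chart of `Bl_{(c)}`. [folklore] -/
theorem chartBase_F_two : ψ F = w ^ 2 * G := by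
  have h1 : ψ (v 0) = w * e'[1] := reesChartBase_apply_eq_mul_chartGen cc j 1
  have h2 : ψ (v 1) = w * e'[2] := reesChartBase_apply_eq_mul_chartGen cc j 2
  have h3 : ψ (v 2) = w * e'[3] := reesChartBase_apply_eq_mul_chartGen cc j 3
  rw [map_add, map_mul, map_pow, h1, h2, h3]
  ring

/-- `ψ(t) = w u'`, `u' = e'₀`. [folklore] -/
theorem chartBase_t_two : ψ t = w * e'[0] := reesChartBase_apply_eq_mul_chartGen cc j 0

/-- **`𝔨 C_j = w · (u', w G)`** for `𝔨 = (t, F)`. [folklore] -/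
theorem map_chartBase_kk :
    (Ideal.span {t, F}).map ψ = Ideal.span {w} * Ideal.span {e'[0], w * G} := by
  rw [Ideal.map_span, Set.image_insert_eq, Set.image_singleton, chartBase_t_two, chartBase_F_two,
    span_singleton_mul_span_pair, pow_two, mul_assoc]

/-- `(v₀, v₁, v₂) C_j = w · (e'₁, e'₂, e'₃)`. [folklore] -/
theorem map_chartBase_span_v :
    (Ideal.span {v 0, v 1, v 2}).map ψ = Ideal.span {w} * Ideal.span {e'[1], e'[2], e'[3]} := by
  have h1 : ψ (v 0) = w * e'[1] := reesChartBase_apply_eq_mul_chartGen cc j 1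
  have h2 : ψ (v 1) = w * e'[2] := reesChartBase_apply_eq_mul_chartGen cc j 2
  have h3 : ψ (v 2) = w * e'[3] := reesChartBase_apply_eq_mul_chartGen cc j 3
  rw [Ideal.map_span, Set.image_insert_eq, Set.image_insert_eq, Set.image_singleton, h1, h2, h3,
    span_singleton_mul_span_triple]

/-- **`𝔴 C_j = w · (w · (e'₁, e'₂, e'₃)² + (u'))`** for `𝔴 = (v₀, v₁, v₂)² + (t)`. [folklore] -/
theorem map_chartBase_ww :
    (Ideal.span {v 0, v 1, v 2} ^ 2 ⊔ Ideal.span {t}).map ψ =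
      Ideal.span {w} * (Ideal.span {w} * Ideal.span {e'[1], e'[2], e'[3]} ^ 2 ⊔
        Ideal.span {e'[0]}) := by
  rw [Ideal.map_sup, Ideal.map_pow, map_chartBase_span_v, Ideal.map_span, Set.image_singleton,
    chartBase_t_two, ← Ideal.span_singleton_mul_span_singleton, mul_pow, Ideal.mul_sup, pow_two,
    mul_assoc]

/-- **The total transform of `𝔨 · 𝔴` on the charts of `Bl_{(c)}`.** [folklore] -/
theorem map_chartBase_kw :
    (Ideal.span {t, F} * (Ideal.span {v 0, v 1, v 2} ^ 2 ⊔ Ideal.span {t})).map ψ =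
      Ideal.span {w ^ 2} * (Ideal.span {e'[0], w * G} *
        (Ideal.span {w} * Ideal.span {e'[1], e'[2], e'[3]} ^ 2 ⊔ Ideal.span {e'[0]})) := by
  rw [Ideal.map_mul, map_chartBase_kk, map_chartBase_ww, ← Ideal.span_singleton_pow]
  ring

/-- **On the `t`-chart (`j = 0`) everything is Cartier**: `(𝔨 𝔴) C₀ = (w²)` (`u' = 1` there).
[folklore] -/
theorem map_chartBase_kw_zero :
    (Ideal.span {t, F} * (Ideal.span {v 0, v 1, v 2} ^ 2 ⊔ Ideal.span {t})).map
      (chartBase cc 0) = Ideal.span {chartBase cc 0 (cc 0) ^ 2} := by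
  rw [map_chartBase_kw]
  have h1 : chartGen cc 0 0 = 1 := chartGen_self cc 0
  have hu : IsUnit (chartGen cc 0 0) := by rw [h1]; exact isUnit_one
  have htop : Ideal.span {chartGen cc 0 0, chartBase cc 0 (cc 0) *
      (chartGen cc 0 1 * chartGen cc 0 2 + chartGen cc 0 3 ^ 2)} = ⊤ :=
    Ideal.eq_top_of_isUnit_mem _ (Ideal.subset_span (Or.inl rfl)) hu
  have htop' : Ideal.span {chartGen cc 0 0} = ⊤ :=
    Ideal.eq_top_of_isUnit_mem _ (Ideal.subset_span rfl) hu
  rw [htop, htop', sup_top_eq, Ideal.top_mul, Ideal.mul_top]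

/-- **On the `v_k`-chart (`j = k + 1`)**: `(𝔨 𝔴) C_j = w² · (u', w G) · (w, u')` (there
`e'_{k+1} = 1`). [folklore] -/
theorem map_chartBase_kw_succ (k : Fin 3) :
    (Ideal.span {t, F} * (Ideal.span {v 0, v 1, v 2} ^ 2 ⊔ Ideal.span {t})).map
      (chartBase cc (Fin.succ k)) =
      Ideal.span {chartBase cc (Fin.succ k) (cc (Fin.succ k)) ^ 2} *
        (Ideal.span {chartGen cc (Fin.succ k) 0, chartBase cc (Fin.succ k) (cc (Fin.succ k)) *
          (chartGen cc (Fin.succ k) 1 * chartGen cc (Fin.succ k) 2 +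
            chartGen cc (Fin.succ k) 3 ^ 2)} *
        Ideal.span {chartBase cc (Fin.succ k) (cc (Fin.succ k)), chartGen cc (Fin.succ k) 0}) := by
  rw [map_chartBase_kw]
  have h1 : chartGen cc (Fin.succ k) (Fin.succ k) = 1 := chartGen_self cc (Fin.succ k)
  have hone : (1 : chartRing cc (Fin.succ k)) ∈ ({chartGen cc (Fin.succ k) 1,
      chartGen cc (Fin.succ k) 2, chartGen cc (Fin.succ k) 3} :
        Set (chartRing cc (Fin.succ k))) := by
    fin_cases k
    · exact Or.inl h1.symm
    · exact Or.inr (Or.inl h1.symm)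
    · exact Or.inr (Or.inr h1.symm)
  have htop : Ideal.span {chartGen cc (Fin.succ k) 1, chartGen cc (Fin.succ k) 2,
      chartGen cc (Fin.succ k) 3} = ⊤ :=
    Ideal.eq_top_of_isUnit_mem _ (Ideal.subset_span hone) isUnit_one
  rw [htop, Ideal.top_pow, Ideal.mul_top, ← Ideal.span_insert]

end AnyRing


/-! ## Index bookkeeping -/

/-- `3 ≠ 0` in `Fin 4`. [folklore] -/ theorem three_ne_zero4 : (3 : Fin 4) ≠ 0 := by decide
/-- `3 ≠ 1` in `Fin 4`. [folklore] -/ theorem three_ne_one4 : (3 : Fin 4) ≠ 1 := by decide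
/-- `3 ≠ 2` in `Fin 4`. [folklore] -/ theorem three_ne_two4 : (3 : Fin 4) ≠ 2 := by decide

/-- `succ k ∉ {0}` in `Fin 4`. [folklore] -/
theorem succ_notMem_zero (k : Fin 3) : (Fin.succ k : Fin 4) ∉ ({0} : Set (Fin 4)) := by
  rw [Set.mem_singleton_iff]; exact Fin.succ_ne_zero k

/-- Membership in the variable set of the stage quotient: `a ≠ j` and `a ≠ 0`. [folklore] -/
theorem ne_and_notMem_zero {a j : Fin 4} (h1 : a ≠ j) (h2 : a ≠ 0) :
    a ≠ j ∧ a ∉ ({0} : Set (Fin 4)) :=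
  ⟨h1, fun h => h2 (Set.mem_singleton_iff.mp h)⟩

end ConeRung

end Summit.ResolutionOfSingularities.ResolutionOfSingularities.Theorems

end
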